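import Mathlib

/-!
# PneNP / OverlapGapAlgebra — `SearchHardWindow`: tightness of the ALGEBRAIC rung (1/2) —
# few skeletons lack a system of distinct representatives at low density

Support (calibration) for the algebraic rung of crux `stmt-PneNP-2460`
(`…SearchHardWindowAffineRung{Core,Count,}`: sign-affine search maps solve `F_k(n, m)` with
probability `≤ (1 - 2^{-k})^{m-n}`, hence fail at every density `α > 1`). This file and its sequel
prove the converse half of the picture: at LOW density the same class SUCCEEDS with probability
`→ 1`, via the copy rule on a system of distinct representatives (SDR: an injective choice of one
variable per clause). Here: the skeletons without an SDR are few.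

* `shwAffT_card_confined` — skeletons whose clauses in `T` only use variables of `W`:
  `(#W^k)^{#T} (n^k)^{m-#T}` (product count);
* `shwAffT_card_noSDR_le` — Hall's marriage theorem (`Finset.all_card_le_biUnion_card_iff_exists_injective`)
  plus a union bound over Hall obstructions (`t` clauses spanning `≤ t-1` variables):
  `#{S : no SDR} ≤ ∑_{t=1}^{m} C(m,t) C(n,t-1) (t-1)^{kt} n^{k(m-t)}` (`m ≤ n`);
* `shwAffT_term_le` — for `k ≥ 2`, `2 ≤ t ≤ m ≤ αn`, `t ≤ n`: one term is
  `≤ (e²α)^t · t · n^{km-1}` (binomials `≤ x^t/t!`, `1/t! ≤ e^t/t^t`);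
* `shwAffT_sum_div_two_pow`, `shwAffT_sum_div_two_pow_le` — `∑ t/2^t ≤ 2`;
* `shwAffT_card_noSDR_le_real` — for `k ≥ 2`, `e²α ≤ 1/2`, `m ≤ αn`: `#{S : no SDR} ≤ 2 n^{km-1}`,
  a `2/n` fraction of all skeletons.
No definitions; axioms `propext`, `Classical.choice`, `Quot.sound`.
-/

set_option linter.dupNamespace false -- `Summit.PneNP.PneNP.…`: summit = sub-problem (D-0017)

namespace Summit.PneNP.PneNP.Theorems

open Finset
open scoped Classical

section SDRCount

variable {m k n : ℕ}

/-- Skeletons confined on `T` to the variable set `W`: a product count. -/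
theorem shwAffT_card_confined (T : Finset (Fin m)) (W : Finset (Fin n)) :
    ((univ : Finset (Fin m → Fin k → Fin n)).filter fun S => ∀ i ∈ T, ∀ j, S i j ∈ W).card =
      (W.card ^ k) ^ T.card * (n ^ k) ^ (m - T.card) := by
  have h1 : ((univ : Finset (Fin m → Fin k → Fin n)).filter fun S => ∀ i ∈ T, ∀ j, S i j ∈ W) =
      Fintype.piFinset fun i => if i ∈ T then Fintype.piFinset (fun _ : Fin k => W) else univ := by
    ext S
    simp only [mem_filter, mem_univ, true_and, Fintype.mem_piFinset]
    constructor
    · intro h i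
      split_ifs with hi
      · exact Fintype.mem_piFinset.2 (h i hi)
      · exact mem_univ _
    · intro h i hi j
      have := h i
      rw [if_pos hi, Fintype.mem_piFinset] at this
      exact this j
  have h2 : ∀ i : Fin m, (if i ∈ T then Fintype.piFinset (fun _ : Fin k => W) else
      (univ : Finset (Fin k → Fin n))).card = if i ∈ T then W.card ^ k else n ^ k := by
    intro i
    split_ifs
    · rw [Fintype.card_piFinset, prod_const, card_univ, Fintype.card_fin]
    · rw [card_univ, Fintype.card_fun, Fintype.card_fin, Fintype.card_fin]
  rw [h1, Fintype.card_piFinset, prod_congr rfl fun i _ => h2 i, Finset.prod_ite, prod_const,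
    prod_const, Finset.filter_univ_mem]
  congr 2
  have : ((univ : Finset (Fin m)).filter fun i => ¬ i ∈ T) = Tᶜ := by
    ext i; simp
  rw [this, Finset.card_compl, Fintype.card_fin]

/-- **Hall obstructions.** If `m ≤ n`, the skeletons WITHOUT a system of distinct representatives
(an injective choice of one variable per clause) are at most
`∑_{t=1}^{m} C(m,t) C(n,t-1) (t-1)^{kt} n^{k(m-t)}` in number. -/
theorem shwAffT_card_noSDR_le (hmn : m ≤ n) :
    ((univ : Finset (Fin m → Fin k → Fin n)).filter fun S =>
        ¬ ∃ f : Fin m → Fin n, Function.Injective f ∧ ∀ i, ∃ j, S i j = f i).card ≤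
      ∑ t ∈ Finset.Icc 1 m, m.choose t * (n.choose (t - 1) * (((t - 1) ^ k) ^ t * (n ^ k) ^ (m - t))) := by
  -- Hall's theorem: no SDR ⇒ a set `T` of clauses spanning fewer than `#T` variables
  have hsub : ((univ : Finset (Fin m → Fin k → Fin n)).filter fun S =>
        ¬ ∃ f : Fin m → Fin n, Function.Injective f ∧ ∀ i, ∃ j, S i j = f i) ⊆
      (Finset.Icc 1 m).biUnion fun t => ((univ : Finset (Fin m)).powersetCard t).biUnion fun T =>
        ((univ : Finset (Fin n)).powersetCard (t - 1)).biUnion fun W =>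
          (univ : Finset (Fin m → Fin k → Fin n)).filter fun S => ∀ i ∈ T, ∀ j, S i j ∈ W := by
    intro S hS
    simp only [mem_filter, mem_univ, true_and] at hS
    have hHall : ¬ ∀ T : Finset (Fin m), T.card ≤ (T.biUnion fun i =>
        (univ : Finset (Fin k)).image fun j => S i j).card := by
      intro h
      apply hS
      obtain ⟨f, hf, hmem⟩ := (Finset.all_card_le_biUnion_card_iff_exists_injective
        (fun i => (univ : Finset (Fin k)).image fun j => S i j)).1 h
      refine ⟨f, hf, fun i => ?_⟩
      have := hmem i
      rw [Finset.mem_image] at this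
      obtain ⟨j, _, hj⟩ := this
      exact ⟨j, hj⟩
    push Not at hHall
    obtain ⟨T, hT⟩ := hHall
    have hT1 : 1 ≤ T.card := by omega
    have hTm : T.card ≤ m := by simpa using T.card_le_univ
    obtain ⟨W, hWsup, -, hWcard⟩ := Finset.exists_subsuperset_card_eq
      (Finset.subset_univ (T.biUnion fun i => (univ : Finset (Fin k)).image fun j => S i j))
      (Nat.le_sub_one_of_lt hT) (by rw [card_univ, Fintype.card_fin]; omega)
    rw [Finset.mem_biUnion]
    refine ⟨T.card, Finset.mem_Icc.2 ⟨hT1, hTm⟩, ?_⟩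
    rw [Finset.mem_biUnion]
    refine ⟨T, Finset.mem_powersetCard.2 ⟨subset_univ _, rfl⟩, ?_⟩
    rw [Finset.mem_biUnion]
    refine ⟨W, Finset.mem_powersetCard.2 ⟨subset_univ _, hWcard⟩, ?_⟩
    simp only [mem_filter, mem_univ, true_and]
    intro i hi j
    apply hWsup
    rw [Finset.mem_biUnion]
    exact ⟨i, hi, Finset.mem_image.2 ⟨j, mem_univ _, rfl⟩⟩
  refine (card_le_card hsub).trans (card_biUnion_le.trans (sum_le_sum fun t ht => ?_))
  refine card_biUnion_le.trans ?_
  calc ∑ T ∈ (univ : Finset (Fin m)).powersetCard t,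
        (((univ : Finset (Fin n)).powersetCard (t - 1)).biUnion fun W =>
          (univ : Finset (Fin m → Fin k → Fin n)).filter fun S => ∀ i ∈ T, ∀ j, S i j ∈ W).card
      ≤ ∑ T ∈ (univ : Finset (Fin m)).powersetCard t,
          (n.choose (t - 1) * (((t - 1) ^ k) ^ t * (n ^ k) ^ (m - t))) := by
        refine sum_le_sum fun T hT => card_biUnion_le.trans ?_
        have hTc : T.card = t := (Finset.mem_powersetCard.1 hT).2
        calc ∑ W ∈ (univ : Finset (Fin n)).powersetCard (t - 1),
              ((univ : Finset (Fin m → Fin k → Fin n)).filter fun S => ∀ i ∈ T, ∀ j, S i j ∈ W).card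
            = ∑ W ∈ (univ : Finset (Fin n)).powersetCard (t - 1),
                (((t - 1) ^ k) ^ t * (n ^ k) ^ (m - t)) := by
              refine sum_congr rfl fun W hW => ?_
              have hWc : W.card = t - 1 := (Finset.mem_powersetCard.1 hW).2
              rw [shwAffT_card_confined, hWc, hTc]
          _ ≤ _ := le_of_eq (by
              rw [sum_const, card_powersetCard, card_univ, Fintype.card_fin, smul_eq_mul])
    _ ≤ _ := le_of_eq (by rw [sum_const, card_powersetCard, card_univ, Fintype.card_fin, smul_eq_mul])

end SDRCount

section SDRAnalytic

variable {m k n : ℕ}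

/-- `∑_{t<M} t/2^t = 2 - 2(M+1)/2^M`. -/
theorem shwAffT_sum_div_two_pow (M : ℕ) :
    (∑ t ∈ Finset.range M, (t : ℝ) / 2 ^ t) = 2 - 2 * (M + 1) / 2 ^ M := by
  induction M with
  | zero => simp
  | succ M ih =>
    rw [Finset.sum_range_succ, ih]
    have h2 : (2 : ℝ) ^ M ≠ 0 := by positivity
    push_cast
    field_simp
    ring

/-- `∑_{t ∈ s} t/2^t ≤ 2` for every finite set of naturals. -/
theorem shwAffT_sum_div_two_pow_le (s : Finset ℕ) : (∑ t ∈ s, (t : ℝ) / 2 ^ t) ≤ 2 := by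
  obtain ⟨M, hM⟩ : ∃ M, s ⊆ Finset.range M := by
    refine ⟨s.sup id + 1, fun t ht => Finset.mem_range.2 ?_⟩
    have := Finset.le_sup (f := id) ht
    simp only [id_eq] at this
    omega
  calc (∑ t ∈ s, (t : ℝ) / 2 ^ t) ≤ ∑ t ∈ Finset.range M, (t : ℝ) / 2 ^ t :=
        Finset.sum_le_sum_of_subset_of_nonneg hM fun t _ _ => by positivity
    _ = 2 - 2 * (M + 1) / 2 ^ M := shwAffT_sum_div_two_pow M
    _ ≤ 2 := by
        have : (0 : ℝ) ≤ 2 * (M + 1) / 2 ^ M := by positivity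
        linarith

/-- **One Hall term.** For `k ≥ 2`, `2 ≤ t ≤ m`, `t ≤ n` and `m ≤ α n`:
`C(m,t) C(n,t-1) (t-1)^{kt} n^{k(m-t)} ≤ (e²α)^t · t · n^{km-1}`. -/
theorem shwAffT_term_le (hk : 2 ≤ k) {t : ℕ} (ht : 2 ≤ t) (htm : t ≤ m) (htn : t ≤ n)
    {α : ℝ} (hα : 0 ≤ α) (hm : (m : ℝ) ≤ α * n) :
    ((m.choose t * (n.choose (t - 1) * (((t - 1) ^ k) ^ t * (n ^ k) ^ (m - t))) : ℕ) : ℝ) ≤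
      (Real.exp 2 * α) ^ t * t * (n : ℝ) ^ (k * m - 1) := by
  have ht0 : (0 : ℝ) < t := by exact_mod_cast (lt_of_lt_of_le (by norm_num) ht)
  have hu1 : (1 : ℝ) ≤ ((t - 1 : ℕ) : ℝ) := by
    rw [Nat.cast_sub (by omega : 1 ≤ t)]
    have : (2 : ℝ) ≤ t := by exact_mod_cast ht
    push_cast
    linarith
  have hu0 : (0 : ℝ) < ((t - 1 : ℕ) : ℝ) := lt_of_lt_of_le one_pos hu1
  have hut : ((t - 1 : ℕ) : ℝ) ≤ t := by exact_mod_cast Nat.sub_le t 1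
  have hun : ((t - 1 : ℕ) : ℝ) ≤ n := by exact_mod_cast (Nat.sub_le t 1).trans htn
  have hn0 : (0 : ℝ) < n := by exact_mod_cast (lt_of_lt_of_le (by omega : 0 < t) htn)
  set u : ℝ := ((t - 1 : ℕ) : ℝ) with hu
  -- binomial and factorial bounds
  have hA : (m.choose t : ℝ) ≤ (α * n) ^ t / (t.factorial : ℝ) := by
    refine (Nat.choose_le_pow_div t m).trans ?_
    exact div_le_div_of_nonneg_right (pow_le_pow_left₀ (Nat.cast_nonneg m) hm t) (by positivity)
  have hB : (n.choose (t - 1) : ℝ) ≤ (n : ℝ) ^ (t - 1) / ((t - 1).factorial : ℝ) :=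
    Nat.choose_le_pow_div (t - 1) n
  have hF1 : 1 / (t.factorial : ℝ) ≤ Real.exp t / (t : ℝ) ^ t := by
    have h := Real.pow_div_factorial_le_exp (t : ℝ) (le_of_lt ht0) t
    rw [div_le_div_iff₀ (by positivity) (by positivity), one_mul]
    rw [div_le_iff₀ (by positivity)] at h
    linarith
  have hF2 : 1 / ((t - 1).factorial : ℝ) ≤ Real.exp u / u ^ (t - 1) := by
    have h := Real.pow_div_factorial_le_exp u hu0.le (t - 1)
    rw [div_le_div_iff₀ (by positivity) (by positivity), one_mul]
    rw [div_le_iff₀ (by positivity)] at h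
    have : ((t - 1 : ℕ) : ℝ) ^ (t - 1) = u ^ (t - 1) := by rw [hu]
    nlinarith [h, this]
  -- the algebraic heart: `u^{kt} / (t^t u^{t-1}) ≤ t · n^{(k-2)t}`
  have hkt : 2 * t ≤ k * t := Nat.mul_le_mul_right t hk
  have hheart : u ^ (k * t) ≤ (t : ℝ) ^ t * u ^ (t - 1) * (t * (n : ℝ) ^ ((k - 2) * t)) := by
    have hsplit : u ^ (k * t) = u ^ t * u ^ (t - 1) * (u * u ^ ((k - 2) * t)) := by
      rw [← pow_succ', ← pow_add, ← pow_add]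
      congr 1
      have h2 : (k - 2) * t = k * t - 2 * t := by
        rw [Nat.sub_mul]
      omega
    rw [hsplit]
    have h1 : u ^ t ≤ (t : ℝ) ^ t := pow_le_pow_left₀ hu0.le hut t
    have h2 : u * u ^ ((k - 2) * t) ≤ t * (n : ℝ) ^ ((k - 2) * t) :=
      mul_le_mul hut (pow_le_pow_left₀ hu0.le hun _) (by positivity) ht0.le
    have h3 : 0 ≤ u ^ (t - 1) := by positivity
    calc u ^ t * u ^ (t - 1) * (u * u ^ ((k - 2) * t))
        ≤ (t : ℝ) ^ t * u ^ (t - 1) * (u * u ^ ((k - 2) * t)) := by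
          gcongr
      _ ≤ (t : ℝ) ^ t * u ^ (t - 1) * (t * (n : ℝ) ^ ((k - 2) * t)) := by
          gcongr
  -- the exponent bookkeeping: `t + (t-1) + k(m-t) + (k-2)t = km - 1`
  have hexp : t + (t - 1) + k * (m - t) + (k - 2) * t = k * m - 1 := by
    have h1 : k * (m - t) = k * m - k * t := Nat.mul_sub k m t
    have h2 : (k - 2) * t = k * t - 2 * t := Nat.sub_mul k 2 t
    have h3 : k * t ≤ k * m := Nat.mul_le_mul_left k htm
    have h4 : 1 ≤ k * m := le_trans (by omega) (le_trans hkt h3)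
    omega
  -- assemble
  have hcast : ((m.choose t * (n.choose (t - 1) * (((t - 1) ^ k) ^ t * (n ^ k) ^ (m - t))) : ℕ) : ℝ) =
      (m.choose t : ℝ) * (n.choose (t - 1) : ℝ) * (u ^ (k * t) * (n : ℝ) ^ (k * (m - t))) := by
    push_cast
    rw [hu, ← pow_mul, ← pow_mul, mul_comm k t]
    ring
  rw [hcast]
  have hpos1 : (0 : ℝ) ≤ u ^ (k * t) * (n : ℝ) ^ (k * (m - t)) := by positivity
  calc (m.choose t : ℝ) * (n.choose (t - 1) : ℝ) * (u ^ (k * t) * (n : ℝ) ^ (k * (m - t)))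
      ≤ ((α * n) ^ t / (t.factorial : ℝ)) * ((n : ℝ) ^ (t - 1) / ((t - 1).factorial : ℝ)) *
          (u ^ (k * t) * (n : ℝ) ^ (k * (m - t))) := by
        apply mul_le_mul_of_nonneg_right _ hpos1
        exact mul_le_mul hA hB (Nat.cast_nonneg _) (by positivity)
    _ = ((α * n) ^ t * (1 / (t.factorial : ℝ))) * ((n : ℝ) ^ (t - 1) * (1 / ((t - 1).factorial : ℝ))) *
          (u ^ (k * t) * (n : ℝ) ^ (k * (m - t))) := by ring
    _ ≤ ((α * n) ^ t * (Real.exp t / (t : ℝ) ^ t)) * ((n : ℝ) ^ (t - 1) * (Real.exp u / u ^ (t - 1))) *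
          (u ^ (k * t) * (n : ℝ) ^ (k * (m - t))) := by
        apply mul_le_mul_of_nonneg_right _ hpos1
        apply mul_le_mul
        · exact mul_le_mul_of_nonneg_left hF1 (by positivity)
        · exact mul_le_mul_of_nonneg_left hF2 (by positivity)
        · positivity
        · positivity
    _ = (α ^ t * (Real.exp t * Real.exp u)) * ((n : ℝ) ^ t * (n : ℝ) ^ (t - 1) *
          (n : ℝ) ^ (k * (m - t))) * (u ^ (k * t) / ((t : ℝ) ^ t * u ^ (t - 1))) := by
        rw [mul_pow]
        field_simp
    _ ≤ (α ^ t * (Real.exp t * Real.exp u)) * ((n : ℝ) ^ t * (n : ℝ) ^ (t - 1) *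
          (n : ℝ) ^ (k * (m - t))) * (t * (n : ℝ) ^ ((k - 2) * t)) := by
        apply mul_le_mul_of_nonneg_left _ (by positivity)
        rw [div_le_iff₀ (by positivity)]
        calc u ^ (k * t) ≤ (t : ℝ) ^ t * u ^ (t - 1) * (t * (n : ℝ) ^ ((k - 2) * t)) := hheart
          _ = t * (n : ℝ) ^ ((k - 2) * t) * ((t : ℝ) ^ t * u ^ (t - 1)) := by ring
    _ = (α ^ t * (Real.exp t * Real.exp u)) * t * (n : ℝ) ^ (k * m - 1) := by
        rw [← hexp, pow_add, pow_add, pow_add]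
        ring
    _ ≤ (Real.exp 2 * α) ^ t * t * (n : ℝ) ^ (k * m - 1) := by
        apply mul_le_mul_of_nonneg_right _ (by positivity)
        apply mul_le_mul_of_nonneg_right _ ht0.le
        rw [mul_pow, ← Real.exp_nat_mul]
        have hexp2 : Real.exp t * Real.exp u ≤ Real.exp (t * 2) := by
          rw [← Real.exp_add]
          apply Real.exp_le_exp.2
          linarith
        calc α ^ t * (Real.exp t * Real.exp u) ≤ α ^ t * Real.exp (t * 2) :=
              mul_le_mul_of_nonneg_left hexp2 (by positivity)
          _ = Real.exp (t * 2) * α ^ t := by ring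


/-- **Few skeletons lack an SDR at low density.** For `k ≥ 2`, `e²α ≤ 1/2` and `m ≤ α n`, at most
`2 n^{km-1}` of the `n^{km}` skeletons have no system of distinct representatives. -/
theorem shwAffT_card_noSDR_le_real (hk : 2 ≤ k) {α : ℝ} (hα : 0 ≤ α)
    (hαe : Real.exp 2 * α ≤ 1 / 2) (hm : (m : ℝ) ≤ α * n) :
    (((univ : Finset (Fin m → Fin k → Fin n)).filter fun S =>
        ¬ ∃ f : Fin m → Fin n, Function.Injective f ∧ ∀ i, ∃ j, S i j = f i).card : ℝ) ≤
      2 * (n : ℝ) ^ (k * m - 1) := by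
  have he : (1 : ℝ) ≤ Real.exp 2 := Real.one_le_exp (by norm_num)
  have hα1 : α ≤ 1 := by nlinarith
  have hmn : m ≤ n := by
    have hn0 : (0 : ℝ) ≤ n := Nat.cast_nonneg n
    have : (m : ℝ) ≤ n := hm.trans (by nlinarith)
    exact_mod_cast this
  have hnat := shwAffT_card_noSDR_le (k := k) hmn
  have hcast : (((univ : Finset (Fin m → Fin k → Fin n)).filter fun S =>
        ¬ ∃ f : Fin m → Fin n, Function.Injective f ∧ ∀ i, ∃ j, S i j = f i).card : ℝ) ≤
      ∑ t ∈ Finset.Icc 1 m, ((m.choose t * (n.choose (t - 1) *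
        (((t - 1) ^ k) ^ t * (n ^ k) ^ (m - t))) : ℕ) : ℝ) := by
    exact_mod_cast hnat
  refine hcast.trans ?_
  have hterm : ∀ t ∈ Finset.Icc 1 m, ((m.choose t * (n.choose (t - 1) *
      (((t - 1) ^ k) ^ t * (n ^ k) ^ (m - t))) : ℕ) : ℝ) ≤ (t : ℝ) / 2 ^ t * (n : ℝ) ^ (k * m - 1) := by
    intro t ht
    rw [Finset.mem_Icc] at ht
    rcases Nat.lt_or_ge t 2 with h1 | h2
    · have ht1 : t = 1 := by omega
      subst ht1
      have hk0 : k ≠ 0 := by omega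
      simp [hk0]
    · have key := shwAffT_term_le (m := m) (n := n) hk h2 ht.2 (ht.2.trans hmn) hα hm
      refine key.trans ?_
      have hρ : (Real.exp 2 * α) ^ t ≤ (1 / 2) ^ t :=
        pow_le_pow_left₀ (by positivity) hαe t
      have hnn : (0 : ℝ) ≤ t * (n : ℝ) ^ (k * m - 1) := by positivity
      calc (Real.exp 2 * α) ^ t * t * (n : ℝ) ^ (k * m - 1)
          = (Real.exp 2 * α) ^ t * (t * (n : ℝ) ^ (k * m - 1)) := by ring
        _ ≤ (1 / 2) ^ t * (t * (n : ℝ) ^ (k * m - 1)) := mul_le_mul_of_nonneg_right hρ hnn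
        _ = (t : ℝ) / 2 ^ t * (n : ℝ) ^ (k * m - 1) := by
            rw [one_div, inv_pow]
            ring
  calc ∑ t ∈ Finset.Icc 1 m, ((m.choose t * (n.choose (t - 1) *
          (((t - 1) ^ k) ^ t * (n ^ k) ^ (m - t))) : ℕ) : ℝ)
      ≤ ∑ t ∈ Finset.Icc 1 m, (t : ℝ) / 2 ^ t * (n : ℝ) ^ (k * m - 1) := sum_le_sum hterm
    _ = (∑ t ∈ Finset.Icc 1 m, (t : ℝ) / 2 ^ t) * (n : ℝ) ^ (k * m - 1) := by rw [sum_mul]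
    _ ≤ 2 * (n : ℝ) ^ (k * m - 1) :=
        mul_le_mul_of_nonneg_right (shwAffT_sum_div_two_pow_le _) (by positivity)

end SDRAnalytic

end Summit.PneNP.PneNP.Theorems
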